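import Summits.BirchSwinnertonDyer.BirchSwinnertonDyer.Theorems.RamifiedSevenEllipticUnitsRubinFormulaZpIffValue
import Summits.BirchSwinnertonDyer.BirchSwinnertonDyer.Theses.PrintCFram
import HarnessLib

/-!
# Route `PrintCFram`, the `@≥5` residual S3 `BottomClassIndexLawFiveLe` (item stmt-BirchSwinnertonDyer-20372)
# BY NAME ⟺ the class-wide ANALYTIC RAMIFIED RUBIN FORMULA `S_open` of cell `bsd-cm`'s line «rubin-formula-zp»
# (cell `bsd-print-cfram`, D-0131 (2) print tier, seat ty2 gen 5 = the cell's discharge-interface typer;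
# planner 2026-08-27T22:31:34Z: «S3 20372 has no consumer by name — a line needs a typed (PR|IMC)ₚ → S3 seam»)

HONEST FRAMING (cell `bsd-print-cfram`, HOME `run/shared/lean/pub/bsd-print-cfram/`): THEOREMS ONLY (no
definition, no named fact, no axiom, no `sorry`); nothing about BSD is booked; S3, r9 `EllipticUnitIMCFiveLe`,
the `@3` crux C1 and the leaf `Summit.BirchSwinnertonDyer.WAllCornerFRamified` stay OPEN; 0 cells move.
This route CITES cell `bsd-cm`'s attack on K7r item 19945 `EllipticUnitValueSevenOfGZK` (the 𝒞₇@7 instance of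
S3) and never duplicates it: the line «rubin-formula-zp» composes four typed stubs over the corrected carrier
`𝒪_𝔭 · z(𝟙)` — `S_dict′ = X12.O11.RamifiedCMLocalMordellWeilDictAtZp W p`, `S_sat-Zp =
X12.O11.RamifiedCMBottomSaturationAtZp W p`, `S_B4′ = X12.O11.RamifiedCMBottomLocalIndexSplitAtZp W p`,
`S_open = X12.O11.RamifiedCMRubinFormulaAtZp W p` (the analytic ramified Rubin formula (★_an)♯: every local
bottom exponent `λ₀(D)` of a pinned datum under the IMC identity equals `2(n + n') + ord_p q + ord_p q'`;
[BKNO] Thm. 7.2 at `χ = 𝟙` + unit bottom period, §1.4 «report elsewhere» — OPEN, NOT in print) — and cell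
`bsd-cm` PROVED the first three at EVERY globally minimal `W` and EVERY prime `p`
(`ramifiedCMLocalMordellWeilDictAtZp_holds`, `BottomSaturationUncond.ramifiedCMBottomSaturationAtZp_holds`,
`ramifiedCMBottomLocalIndexSplitAtZp_holds`), whence the hypothesis-free equivalence
`RubinFormulaZpIffValue.ramifiedCMRubinFormulaAtZp_iff_indexLawAtZp_holds :
RamifiedCMRubinFormulaAtZp W p ↔ RamifiedCMBottomClassIndexLawAtZp W p` (p474028 ff.). Read on the leaf at
`p ≥ 5`, BY NAME against the route decl:

* `bottomClassIndexLawFiveLe_of_rubinFormulaZp` — **S3 ⟸ class-wide `S_open` on the leaf at `p ≥ 5`**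
  (the GZK antecedent of S3 is not even used: saturation is unconditional in the kernel);
* `rubinFormulaZp_of_bottomClassIndexLawFiveLe` — the converse under S3's own antecedent GZK, and
  `bottomClassIndexLawFiveLe_iff_rubinFormulaZp_of_GZK` — **S3 ⟺ (GZK → class-wide `S_open`)**: in the
  kernel the residual S3 IS the analytic ramified Rubin formula at every ramified `p ≥ 5`, class-wide;
* `wAllCornerFRamified_of_rubinFormulaZp` — the leaf K12r from C1 ∧ class-wide `S_open` ∧ r9 ∧ the four
  refereed facts, through the route's deciding theorem `Theses.PrintCFram.closes`.
So a registered line on S3 needs ONE stub, `∀ W p ≥ 5 on the leaf, X12.O11.RamifiedCMRubinFormulaAtZp W p`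
(turnkey skeleton with the planner). beyond-print theorem: NO.

References: [BurungaleKobayashiNakamuraOta2026] arXiv:2608.06879v1 §1.4, Lemma 7.1, Thm. 7.2 (pp. 8,
40–41; claim; preprint; shape only); [PerrinRiou1987BSMF] §0 pp. 401–402; [Miller2011LMS] §1, Def. 1.1
(arXiv:1010.2431 p. 3); route file `Theses/PrintCFram.lean` rev ≥ 21 (items 20372, 20373, 20371, 20374);
cell `bsd-cm` files `X12/O11/RamifiedRubinFormulaLineZp.lean` (p467346),
`Theorems/RamifiedSevenEllipticUnitsRubinFormulaZpIffValue.lean`.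
-/

noncomputable section

open WeierstrassCurve Literature.NumberTheory.EllipticCurves Literature.NumberTheory.EllipticCurves.Rank1Residual
  Summit.BirchSwinnertonDyer.Rank1Residual
  Summit.BirchSwinnertonDyer.Rank1Residual.X12.O11
  Summit.BirchSwinnertonDyer.BirchSwinnertonDyer.Theorems.RamifiedSevenEllipticUnits

namespace Summit.BirchSwinnertonDyer.Rank1Residual.PrintCfram

/-! ## S3 `BottomClassIndexLawFiveLe` ⟺ the class-wide analytic ramified Rubin formula at `p ≥ 5` -/

/-- **S3 ⟸ class-wide `S_open`, BY NAME**: if the analytic ramified Rubin formula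
`X12.O11.RamifiedCMRubinFormulaAtZp W p` holds for every globally minimal CM curve `W/ℚ` of analytic rank one
and every prime `p ≥ 5` ramified in the CM field, then the route's residual S3
`Theses.PrintCFram.BottomClassIndexLawFiveLe` holds — pointwise cell `bsd-cm`'s hypothesis-free
`ramifiedCMRubinFormulaAtZp_iff_indexLawAtZp_holds` (S_dict′, S_sat-Zp, S_B4′ proved at every `W`, `p`); the
GZK antecedent of S3 is discarded. CONDITIONAL on the displayed class-wide `S_open` (OPEN, beyond print);
nothing booked. [cite: BurungaleKobayashiNakamuraOta2026, §1.4 and Thm. 7.2 (arXiv:2608.06879 pp. 8, 41) (the objects; claim; preprint; shape only)]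
[cite: Miller2011LMS, Def. 1.1 (arXiv:1010.2431 p. 3)] -/
theorem bottomClassIndexLawFiveLe_of_rubinFormulaZp
    (hopen : ∀ (W : WeierstrassCurve ℚ) [W.IsElliptic] [W.IsGloballyMinimal] (p : ℕ) [Fact p.Prime],
      W.HasCM → CMRamified W p → 5 ≤ p → W.analyticRank = 1 → RamifiedCMRubinFormulaAtZp W p) :
    Summit.BirchSwinnertonDyer.BirchSwinnertonDyer.Theses.PrintCFram.BottomClassIndexLawFiveLe :=
  fun _ W _ _ p _ hCM hram h5 hr =>
    RubinFormulaZpIffValue.ramifiedCMRubinFormulaAtZp_iff_indexLawAtZp_holds.1 (hopen W p hCM hram h5 hr)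

/-- **S3 ∧ GZK ⟹ class-wide `S_open`** (the converse, under S3's own published antecedent
`rank_eq_analyticRank_of_analyticRank_le_one`): pointwise the `.2` direction of cell `bsd-cm`'s equivalence.
[cite: Miller2011LMS, Def. 1.1 (arXiv:1010.2431 p. 3)] [cite: Kolyvagin1990, Thm. A] -/
theorem rubinFormulaZp_of_bottomClassIndexLawFiveLe
    (h : Summit.BirchSwinnertonDyer.BirchSwinnertonDyer.Theses.PrintCFram.BottomClassIndexLawFiveLe)
    (hGZK : rank_eq_analyticRank_of_analyticRank_le_one) :
    ∀ (W : WeierstrassCurve ℚ) [W.IsElliptic] [W.IsGloballyMinimal] (p : ℕ) [Fact p.Prime],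
      W.HasCM → CMRamified W p → 5 ≤ p → W.analyticRank = 1 → RamifiedCMRubinFormulaAtZp W p :=
  fun W _ _ p _ hCM hram h5 hr =>
    RubinFormulaZpIffValue.ramifiedCMRubinFormulaAtZp_iff_indexLawAtZp_holds.2 (h hGZK W p hCM hram h5 hr)

/-- **S3 ⟺ (GZK → class-wide `S_open`)**: in the kernel the route's `@≥5` residual S3 IS the class-wide
analytic ramified Rubin formula at every ramified `p ≥ 5` under its own antecedent — the `p ≥ 5` analogue of
cell `bsd-cm`'s `rubinFormulaSevenZp_iff_valueSevenOfGZK` on 𝒞₇ (K7r item 19945). Nothing asserted about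
either side. [cite: BurungaleKobayashiNakamuraOta2026, §1.4 and Thm. 7.2 (arXiv:2608.06879 pp. 8, 41) (the objects; claim; preprint; shape only)]
[cite: Miller2011LMS, Def. 1.1 (arXiv:1010.2431 p. 3)] -/
theorem bottomClassIndexLawFiveLe_iff_rubinFormulaZp_of_GZK :
    Summit.BirchSwinnertonDyer.BirchSwinnertonDyer.Theses.PrintCFram.BottomClassIndexLawFiveLe ↔
      (rank_eq_analyticRank_of_analyticRank_le_one →
        ∀ (W : WeierstrassCurve ℚ) [W.IsElliptic] [W.IsGloballyMinimal] (p : ℕ) [Fact p.Prime],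
          W.HasCM → CMRamified W p → 5 ≤ p → W.analyticRank = 1 → RamifiedCMRubinFormulaAtZp W p) :=
  ⟨fun h hGZK => rubinFormulaZp_of_bottomClassIndexLawFiveLe h hGZK,
    fun h hGZK W _ _ p _ hCM hram h5 hr =>
      RubinFormulaZpIffValue.ramifiedCMRubinFormulaAtZp_iff_indexLawAtZp_holds.1
        (h hGZK W p hCM hram h5 hr)⟩

/-! ## The leaf through the route's deciding theorem, with S3 fed by `S_open` -/

/-- **K12r ⟸ C1 ∧ class-wide `S_open` ∧ r9 ∧ the four refereed facts**, BY NAME through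
`Theses.PrintCFram.closes`: the leaf `Summit.BirchSwinnertonDyer.WAllCornerFRamified` from the `@3` crux
`CMRamifiedThreeBSD` (item 20371), the class-wide analytic ramified Rubin formula at `p ≥ 5` (in place of S3,
item 20372), the `∃`-form elliptic-unit IMC `EllipticUnitIMCFiveLe` (item 20373) and `PublishedFactsCFram`
(item 20374). CONDITIONAL on all four displayed hypotheses; nothing booked; 0 cells move.
[cite: Miller2011LMS, §1 and Def. 1.1 (arXiv:1010.2431 p. 3)] [cite: GrossZagier1986, Thm. I.(7.3)] -/
theorem wAllCornerFRamified_of_rubinFormulaZp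
    (h₁ : Summit.BirchSwinnertonDyer.BirchSwinnertonDyer.Theses.PrintCFram.CMRamifiedThreeBSD)
    (hopen : ∀ (W : WeierstrassCurve ℚ) [W.IsElliptic] [W.IsGloballyMinimal] (p : ℕ) [Fact p.Prime],
      W.HasCM → CMRamified W p → 5 ≤ p → W.analyticRank = 1 → RamifiedCMRubinFormulaAtZp W p)
    (h₃ : Summit.BirchSwinnertonDyer.BirchSwinnertonDyer.Theses.PrintCFram.EllipticUnitIMCFiveLe)
    (h₄ : Summit.BirchSwinnertonDyer.BirchSwinnertonDyer.Theses.PrintCFram.PublishedFactsCFram) :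
    Summit.BirchSwinnertonDyer.WAllCornerFRamified :=
  Summit.BirchSwinnertonDyer.BirchSwinnertonDyer.Theses.PrintCFram.closes h₁
    (bottomClassIndexLawFiveLe_of_rubinFormulaZp hopen) h₃ h₄

end Summit.BirchSwinnertonDyer.Rank1Residual.PrintCfram

end
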